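import Summits.CriticalPhenomena.PercolationContinuityZ3.Theorems.PercNearOneGluingNoHeavyQuantLongTailQuintHubAlgA
import Summits.CriticalPhenomena.PercolationContinuityZ3.Theorems.PercNearOneGluingNoHeavyQuantLongTailQuintHubAlgC1
import Summits.CriticalPhenomena.PercolationContinuityZ3.Theorems.PercNearOneGluingNoHeavyQuantLongTailQuintHubAlgC2
import HarnessLib

/-!
# QUANT lane R8, T-DEC: ALGEBRA OF THE LONG-TAIL QUINT HUB IN `(lo, K)` UNITS, PART 1 — the route capacities of the width-5 sub-floor hub
# `S(γ₁) ∗ ⋯ ∗ S(γ₅)` of shape `{lo, lo+K; γ}`, `2lo ≤ K ≤ 4lo`, as used by the route file (census-1 gen 35)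

builds on p205010 (kernel theorem, internal audit signed; external expert review pending)

Support file (`--supports stmt-CriticalPhenomena-4575`), QUANT lane seat prim-quant-census-1 (gen 35); memo
`run/shared/lean/prim/quant/prim-quant-census-1/g35/QUADHUB-G35.md` §5.  Theorems only, standard axioms, no sorries.  The width-5 twin of
`…QuantLongTailQuadHubAlgK`: the closed forms of `…QuantLongTailQuintHubAlg{A,C1,C2,E,G}` (K-units, worst credit) transported to the route file's variables
(`lo, K, D = T − 10lo`, gates `gᵢ` with `lo ≤ Kgᵢ`, masses `u₀..u₄` of the atoms `5lo + sK`) with the monotone reduction in the credit, AND the three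
DERIVED credit forms: the credit capacity of each route follows from its floor core by a one-line comparison of thresholds
(`u_t/u_s ≥ (S+10c)/(5−5c−S)` beats `S/(3−S)`, `S/(4−S)`, `(S−2)/(4−S)` on the regime since `S ≤ 5(1−c)` and `c ≥ 1/4`), so no certificate is needed
for them.
* `quintHub_masses_nonneg`; `quintHub_capAx` (`x(u₀+u₂) ≤ u₂`, least gate); `quintHub_capBK` (`D·u₀ ≤ (2K−D)u₂`, `0 ≤ D ≤ K`); `quintHub_capCK`
  (`(D+10lo)(u₀+u₃) ≤ 5(lo+K)u₃`, `K ≤ D ≤ 2K`); `quintHub_capDK` (`D·u₀ ≤ (3K−D)u₃`, derived from C1/C2).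

HONEST STATUS.  Algebra only; `SiblingStep`, `GluedDominatedMass`, `SDECConvClosed`, `FarTreeRow` OPEN; RATE class (log\*) / honest sentence of
`run/shared/lean/prim/quant/README.md` unchanged.  [this work].  Nothing here is cited as a published result.  The gluing rows served
[cite: KozmaNitzan2024, Conjecture 3 (p. 15)]; product measure [cite: Grimmett1999, §1.3 p. 10].
-/

noncomputable section

namespace Summit.CriticalPhenomena.PercolationContinuityZ3.Theorems
namespace Quant
namespace LawDec

/-! ### The capacities of the width-5 hub in `(lo, K)` units (`c = lo/K`, `d = D/K`) -/

/-- masses of the width-5 hub are nonnegative for gates in `[0,1]`. [this work] -/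
theorem quintHub_masses_nonneg (g₁ g₂ g₃ g₄ g₅ : ℝ) (h1 : 0 ≤ g₁) (h2 : 0 ≤ g₂) (h3 : 0 ≤ g₃) (h4 : 0 ≤ g₄) (h5 : 0 ≤ g₅)
    (h11 : g₁ ≤ 1) (h21 : g₂ ≤ 1) (h31 : g₃ ≤ 1) (h41 : g₄ ≤ 1) (h51 : g₅ ≤ 1) :
    0 ≤ ((1 - g₁) * (1 - g₂) * (1 - g₃) * (1 - g₄) * (1 - g₅)) ∧
    0 ≤ (g₁ * (1 - g₂) * (1 - g₃) * (1 - g₄) * (1 - g₅) + g₂ * (1 - g₁) * (1 - g₃) * (1 - g₄) * (1 - g₅)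
          + g₃ * (1 - g₁) * (1 - g₂) * (1 - g₄) * (1 - g₅) + g₄ * (1 - g₁) * (1 - g₂) * (1 - g₃) * (1 - g₅)
          + g₅ * (1 - g₁) * (1 - g₂) * (1 - g₃) * (1 - g₄)) ∧
    0 ≤ (g₁ * g₂ * (1 - g₃) * (1 - g₄) * (1 - g₅) + g₁ * g₃ * (1 - g₂) * (1 - g₄) * (1 - g₅) + g₁ * g₄ * (1 - g₂) * (1 - g₃) * (1 - g₅)
          + g₁ * g₅ * (1 - g₂) * (1 - g₃) * (1 - g₄) + g₂ * g₃ * (1 - g₁) * (1 - g₄) * (1 - g₅) + g₂ * g₄ * (1 - g₁) * (1 - g₃) * (1 - g₅)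
          + g₂ * g₅ * (1 - g₁) * (1 - g₃) * (1 - g₄) + g₃ * g₄ * (1 - g₁) * (1 - g₂) * (1 - g₅) + g₃ * g₅ * (1 - g₁) * (1 - g₂) * (1 - g₄)
          + g₄ * g₅ * (1 - g₁) * (1 - g₂) * (1 - g₃)) ∧
    0 ≤ (g₁ * g₂ * g₃ * (1 - g₄) * (1 - g₅) + g₁ * g₂ * g₄ * (1 - g₃) * (1 - g₅) + g₁ * g₂ * g₅ * (1 - g₃) * (1 - g₄)
          + g₁ * g₃ * g₄ * (1 - g₂) * (1 - g₅) + g₁ * g₃ * g₅ * (1 - g₂) * (1 - g₄) + g₁ * g₄ * g₅ * (1 - g₂) * (1 - g₃)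
          + g₂ * g₃ * g₄ * (1 - g₁) * (1 - g₅) + g₂ * g₃ * g₅ * (1 - g₁) * (1 - g₄) + g₂ * g₄ * g₅ * (1 - g₁) * (1 - g₃)
          + g₃ * g₄ * g₅ * (1 - g₁) * (1 - g₂)) ∧
    0 ≤ (g₁ * g₂ * g₃ * g₄ * (1 - g₅) + g₁ * g₂ * g₃ * g₅ * (1 - g₄) + g₁ * g₂ * g₄ * g₅ * (1 - g₃) + g₁ * g₃ * g₄ * g₅ * (1 - g₂)
          + g₂ * g₃ * g₄ * g₅ * (1 - g₁)) := by
  have e1 := sub_nonneg.2 h11; have e2 := sub_nonneg.2 h21; have e3 := sub_nonneg.2 h31; have e4 := sub_nonneg.2 h41; have e5 := sub_nonneg.2 h51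
  exact ⟨by positivity, by positivity, by positivity, by positivity, by positivity⟩

set_option maxHeartbeats 800000 in
/-- **floor capacity of `5lo → 5lo+2K` in `(lo,K)` units**: `x·(u₀+u₂) ≤ u₂` for the least gate `g₁ ≥ lo/K`, `x(lo+K) ≤ lo + Kg₁`. [this work] -/
theorem quintHub_capAx (lo K g₁ g₂ g₃ g₄ g₅ x : ℝ) (hlo : 0 < lo) (hK2 : 2 * lo ≤ K) (hK8 : K ≤ 4 * lo) (hg : lo ≤ K * g₁)
    (h12 : g₁ ≤ g₂) (h13 : g₁ ≤ g₃) (h14 : g₁ ≤ g₄) (h15 : g₁ ≤ g₅) (h21 : g₂ ≤ 1) (h31 : g₃ ≤ 1) (h41 : g₄ ≤ 1) (h51 : g₅ ≤ 1)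
    (hx : x * (lo + K) ≤ lo + K * g₁) :
    x * (((1 - g₁) * (1 - g₂) * (1 - g₃) * (1 - g₄) * (1 - g₅))
        + (g₁ * g₂ * (1 - g₃) * (1 - g₄) * (1 - g₅) + g₁ * g₃ * (1 - g₂) * (1 - g₄) * (1 - g₅) + g₁ * g₄ * (1 - g₂) * (1 - g₃) * (1 - g₅)
          + g₁ * g₅ * (1 - g₂) * (1 - g₃) * (1 - g₄) + g₂ * g₃ * (1 - g₁) * (1 - g₄) * (1 - g₅) + g₂ * g₄ * (1 - g₁) * (1 - g₃) * (1 - g₅)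
          + g₂ * g₅ * (1 - g₁) * (1 - g₃) * (1 - g₄) + g₃ * g₄ * (1 - g₁) * (1 - g₂) * (1 - g₅) + g₃ * g₅ * (1 - g₁) * (1 - g₂) * (1 - g₄)
          + g₄ * g₅ * (1 - g₁) * (1 - g₂) * (1 - g₃)))
      ≤ (g₁ * g₂ * (1 - g₃) * (1 - g₄) * (1 - g₅) + g₁ * g₃ * (1 - g₂) * (1 - g₄) * (1 - g₅) + g₁ * g₄ * (1 - g₂) * (1 - g₃) * (1 - g₅)
          + g₁ * g₅ * (1 - g₂) * (1 - g₃) * (1 - g₄) + g₂ * g₃ * (1 - g₁) * (1 - g₄) * (1 - g₅) + g₂ * g₄ * (1 - g₁) * (1 - g₃) * (1 - g₅)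
          + g₂ * g₅ * (1 - g₁) * (1 - g₃) * (1 - g₄) + g₃ * g₄ * (1 - g₁) * (1 - g₂) * (1 - g₅) + g₃ * g₅ * (1 - g₁) * (1 - g₂) * (1 - g₄)
          + g₄ * g₅ * (1 - g₁) * (1 - g₂) * (1 - g₃)) := by
  have hK : 0 < K := by linarith
  set c : ℝ := lo / K with hc
  have hcK : c * K = lo := by rw [hc]; field_simp
  have hc4 : 1 / 4 ≤ c := by rw [hc, le_div_iff₀ hK]; linarith
  have hc2 : c ≤ 1 / 2 := by rw [hc, div_le_iff₀ hK]; linarith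
  have h1 : c ≤ g₁ := by rw [hc, div_le_iff₀ hK]; linarith
  have h11 : g₁ ≤ 1 := le_trans h12 h21
  have hA := quintHub_capA g₁ g₂ g₃ g₄ g₅ c hc4 hc2 h1 h12 h13 h14 h15 h11 h21 h31 h41 h51
  have hg1 : 0 ≤ g₁ := le_trans (by rw [hc]; positivity) h1
  obtain ⟨n0, -, n2, -, -⟩ := quintHub_masses_nonneg g₁ g₂ g₃ g₄ g₅ hg1 (by linarith) (by linarith) (by linarith) (by linarith) h11 h21 h31 h41 h51
  set U0 := ((1 - g₁) * (1 - g₂) * (1 - g₃) * (1 - g₄) * (1 - g₅)) with hU0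
  set U2 := (g₁ * g₂ * (1 - g₃) * (1 - g₄) * (1 - g₅) + g₁ * g₃ * (1 - g₂) * (1 - g₄) * (1 - g₅) + g₁ * g₄ * (1 - g₂) * (1 - g₃) * (1 - g₅)
          + g₁ * g₅ * (1 - g₂) * (1 - g₃) * (1 - g₄) + g₂ * g₃ * (1 - g₁) * (1 - g₄) * (1 - g₅) + g₂ * g₄ * (1 - g₁) * (1 - g₃) * (1 - g₅)
          + g₂ * g₅ * (1 - g₁) * (1 - g₃) * (1 - g₄) + g₃ * g₄ * (1 - g₁) * (1 - g₂) * (1 - g₅) + g₃ * g₅ * (1 - g₁) * (1 - g₂) * (1 - g₄)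
          + g₄ * g₅ * (1 - g₁) * (1 - g₂) * (1 - g₃)) with hU2
  clear_value c U0 U2
  have hAK : (lo + K * g₁) * (U0 + U2) ≤ (lo + K) * U2 := by
    have := mul_le_mul_of_nonneg_left hA hK.le
    have e1 : K * ((c + g₁) * (U0 + U2)) = (lo + K * g₁) * (U0 + U2) := by rw [← hcK]; ring
    have e2 : K * ((1 + c) * U2) = (lo + K) * U2 := by rw [← hcK]; ring
    linarith [e1, e2]
  have h2 : x * (lo + K) * (U0 + U2) ≤ (lo + K * g₁) * (U0 + U2) := mul_le_mul_of_nonneg_right hx (add_nonneg n0 n2)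
  have h3 : (lo + K) * (x * (U0 + U2)) ≤ (lo + K) * U2 := by linarith
  exact le_of_mul_le_mul_left h3 (by linarith)

set_option maxHeartbeats 800000 in
/-- **credit capacity of `5lo → 5lo+2K`**: `D·u₀ ≤ (2K − D)·u₂` for `0 ≤ D ≤ K`, `D ≤ K·Λ − 5lo` (cores B1: `S ≤ 1`, B2: `S ≥ 1`, monotone in `d`). [this work] -/
theorem quintHub_capBK (lo K g₁ g₂ g₃ g₄ g₅ D : ℝ) (hlo : 0 < lo) (hK2 : 2 * lo ≤ K) (hK8 : K ≤ 4 * lo)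
    (hg₁ : lo ≤ K * g₁) (hg₂ : lo ≤ K * g₂) (hg₃ : lo ≤ K * g₃) (hg₄ : lo ≤ K * g₄) (hg₅ : lo ≤ K * g₅)
    (h11 : g₁ ≤ 1) (h21 : g₂ ≤ 1) (h31 : g₃ ≤ 1) (h41 : g₄ ≤ 1) (h51 : g₅ ≤ 1)
    (hD1 : D ≤ K) (hDS : D ≤ K * (g₁ + g₂ + g₃ + g₄ + g₅) - 5 * lo) :
    D * ((1 - g₁) * (1 - g₂) * (1 - g₃) * (1 - g₄) * (1 - g₅))
      ≤ (2 * K - D) * (g₁ * g₂ * (1 - g₃) * (1 - g₄) * (1 - g₅) + g₁ * g₃ * (1 - g₂) * (1 - g₄) * (1 - g₅) + g₁ * g₄ * (1 - g₂) * (1 - g₃) * (1 - g₅)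
          + g₁ * g₅ * (1 - g₂) * (1 - g₃) * (1 - g₄) + g₂ * g₃ * (1 - g₁) * (1 - g₄) * (1 - g₅) + g₂ * g₄ * (1 - g₁) * (1 - g₃) * (1 - g₅)
          + g₂ * g₅ * (1 - g₁) * (1 - g₃) * (1 - g₄) + g₃ * g₄ * (1 - g₁) * (1 - g₂) * (1 - g₅) + g₃ * g₅ * (1 - g₁) * (1 - g₂) * (1 - g₄)
          + g₄ * g₅ * (1 - g₁) * (1 - g₂) * (1 - g₃)) := by
  have hK : 0 < K := by linarith
  set c : ℝ := lo / K with hc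
  have hcK : c * K = lo := by rw [hc]; field_simp
  have hc4 : 1 / 4 ≤ c := by rw [hc, le_div_iff₀ hK]; linarith
  have hc2 : c ≤ 1 / 2 := by rw [hc, div_le_iff₀ hK]; linarith
  have h1 : c ≤ g₁ := by rw [hc, div_le_iff₀ hK]; linarith
  have h2 : c ≤ g₂ := by rw [hc, div_le_iff₀ hK]; linarith
  have h3 : c ≤ g₃ := by rw [hc, div_le_iff₀ hK]; linarith
  have h4 : c ≤ g₄ := by rw [hc, div_le_iff₀ hK]; linarith
  have h5 : c ≤ g₅ := by rw [hc, div_le_iff₀ hK]; linarith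
  have hg1 : 0 ≤ g₁ := le_trans (by rw [hc]; positivity) h1
  have hg2 : 0 ≤ g₂ := le_trans (by rw [hc]; positivity) h2
  have hg3 : 0 ≤ g₃ := le_trans (by rw [hc]; positivity) h3
  have hg4 : 0 ≤ g₄ := le_trans (by rw [hc]; positivity) h4
  have hg5 : 0 ≤ g₅ := le_trans (by rw [hc]; positivity) h5
  obtain ⟨n0, n1, n2, n3, n4⟩ := quintHub_masses_nonneg g₁ g₂ g₃ g₄ g₅ hg1 hg2 hg3 hg4 hg5 h11 h21 h31 h41 h51
  set U0 := ((1 - g₁) * (1 - g₂) * (1 - g₃) * (1 - g₄) * (1 - g₅)) with hU0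
  set U1 := (g₁ * (1 - g₂) * (1 - g₃) * (1 - g₄) * (1 - g₅) + g₂ * (1 - g₁) * (1 - g₃) * (1 - g₄) * (1 - g₅)
          + g₃ * (1 - g₁) * (1 - g₂) * (1 - g₄) * (1 - g₅) + g₄ * (1 - g₁) * (1 - g₂) * (1 - g₃) * (1 - g₅)
          + g₅ * (1 - g₁) * (1 - g₂) * (1 - g₃) * (1 - g₄)) with hU1
  set U2 := (g₁ * g₂ * (1 - g₃) * (1 - g₄) * (1 - g₅) + g₁ * g₃ * (1 - g₂) * (1 - g₄) * (1 - g₅) + g₁ * g₄ * (1 - g₂) * (1 - g₃) * (1 - g₅)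
          + g₁ * g₅ * (1 - g₂) * (1 - g₃) * (1 - g₄) + g₂ * g₃ * (1 - g₁) * (1 - g₄) * (1 - g₅) + g₂ * g₄ * (1 - g₁) * (1 - g₃) * (1 - g₅)
          + g₂ * g₅ * (1 - g₁) * (1 - g₃) * (1 - g₄) + g₃ * g₄ * (1 - g₁) * (1 - g₂) * (1 - g₅) + g₃ * g₅ * (1 - g₁) * (1 - g₂) * (1 - g₄)
          + g₄ * g₅ * (1 - g₁) * (1 - g₂) * (1 - g₃)) with hU2
  set U3 := (g₁ * g₂ * g₃ * (1 - g₄) * (1 - g₅) + g₁ * g₂ * g₄ * (1 - g₃) * (1 - g₅) + g₁ * g₂ * g₅ * (1 - g₃) * (1 - g₄)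
          + g₁ * g₃ * g₄ * (1 - g₂) * (1 - g₅) + g₁ * g₃ * g₅ * (1 - g₂) * (1 - g₄) + g₁ * g₄ * g₅ * (1 - g₂) * (1 - g₃)
          + g₂ * g₃ * g₄ * (1 - g₁) * (1 - g₅) + g₂ * g₃ * g₅ * (1 - g₁) * (1 - g₄) + g₂ * g₄ * g₅ * (1 - g₁) * (1 - g₃)
          + g₃ * g₄ * g₅ * (1 - g₁) * (1 - g₂)) with hU3
  set U4 := (g₁ * g₂ * g₃ * g₄ * (1 - g₅) + g₁ * g₂ * g₃ * g₅ * (1 - g₄) + g₁ * g₂ * g₄ * g₅ * (1 - g₃) + g₁ * g₃ * g₄ * g₅ * (1 - g₂)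
          + g₂ * g₃ * g₄ * g₅ * (1 - g₁)) with hU4
  clear_value c U0 U1 U2 U3 U4
  by_cases hS : g₁ + g₂ + g₃ + g₄ + g₅ ≤ 5 * c + 1
  · have hB := quintHub_capB1 g₁ g₂ g₃ g₄ g₅ c hc4 h1 h2 h3 h4 h5 h11 h21 h31 h41 h51 hS
    rw [← hU0, ← hU2] at hB
    -- `D·U0 ≤ K·S·U0 ≤ K(2−S)U2 ≤ (2K−D)U2`
    have hDK : D ≤ K * ((g₁ + g₂ + g₃ + g₄ + g₅) - 5 * c) := by linarith [hcK]
    have h6 := mul_le_mul_of_nonneg_right hDK n0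
    have h7 := mul_le_mul_of_nonneg_left hB hK.le
    have h8 : (K * (2 - ((g₁ + g₂ + g₃ + g₄ + g₅) - 5 * c))) * U2 ≤ (2 * K - D) * U2 := mul_le_mul_of_nonneg_right (by linarith) n2
    linarith [h6, h7, h8]
  · push Not at hS
    have hB := quintHub_capB2 g₁ g₂ g₃ g₄ g₅ c hc4 h1 h2 h3 h4 h5 h11 h21 h31 h41 h51
    rw [← hU0, ← hU2] at hB
    have h6 : D * U0 ≤ K * U0 := mul_le_mul_of_nonneg_right hD1 n0
    have h7 : K * U0 ≤ K * U2 := mul_le_mul_of_nonneg_left hB hK.le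
    have h8 : K * U2 ≤ (2 * K - D) * U2 := mul_le_mul_of_nonneg_right (by linarith) n2
    linarith

set_option maxHeartbeats 800000 in
/-- **floor capacity of `5lo → 5lo+3K`**: `(D + 10lo)(u₀+u₃) ≤ 5(lo+K)·u₃` for `K ≤ D ≤ 2K`, `D ≤ K·Λ − 5lo` (cores C1 at the worst credit `S` when `S ≤ 2`,
C2 at `d = 2` when `S ≥ 2`). [this work] -/
theorem quintHub_capCK (lo K g₁ g₂ g₃ g₄ g₅ D : ℝ) (hlo : 0 < lo) (hK2 : 2 * lo ≤ K) (hK8 : K ≤ 4 * lo)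
    (hg₁ : lo ≤ K * g₁) (hg₂ : lo ≤ K * g₂) (hg₃ : lo ≤ K * g₃) (hg₄ : lo ≤ K * g₄) (hg₅ : lo ≤ K * g₅)
    (h11 : g₁ ≤ 1) (h21 : g₂ ≤ 1) (h31 : g₃ ≤ 1) (h41 : g₄ ≤ 1) (h51 : g₅ ≤ 1)
    (hD1 : K ≤ D) (hD2 : D ≤ 2 * K) (hDS : D ≤ K * (g₁ + g₂ + g₃ + g₄ + g₅) - 5 * lo) :
    (D + 10 * lo) * (((1 - g₁) * (1 - g₂) * (1 - g₃) * (1 - g₄) * (1 - g₅))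
        + (g₁ * g₂ * g₃ * (1 - g₄) * (1 - g₅) + g₁ * g₂ * g₄ * (1 - g₃) * (1 - g₅) + g₁ * g₂ * g₅ * (1 - g₃) * (1 - g₄)
          + g₁ * g₃ * g₄ * (1 - g₂) * (1 - g₅) + g₁ * g₃ * g₅ * (1 - g₂) * (1 - g₄) + g₁ * g₄ * g₅ * (1 - g₂) * (1 - g₃)
          + g₂ * g₃ * g₄ * (1 - g₁) * (1 - g₅) + g₂ * g₃ * g₅ * (1 - g₁) * (1 - g₄) + g₂ * g₄ * g₅ * (1 - g₁) * (1 - g₃)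
          + g₃ * g₄ * g₅ * (1 - g₁) * (1 - g₂)))
      ≤ 5 * (lo + K) * (g₁ * g₂ * g₃ * (1 - g₄) * (1 - g₅) + g₁ * g₂ * g₄ * (1 - g₃) * (1 - g₅) + g₁ * g₂ * g₅ * (1 - g₃) * (1 - g₄)
          + g₁ * g₃ * g₄ * (1 - g₂) * (1 - g₅) + g₁ * g₃ * g₅ * (1 - g₂) * (1 - g₄) + g₁ * g₄ * g₅ * (1 - g₂) * (1 - g₃)
          + g₂ * g₃ * g₄ * (1 - g₁) * (1 - g₅) + g₂ * g₃ * g₅ * (1 - g₁) * (1 - g₄) + g₂ * g₄ * g₅ * (1 - g₁) * (1 - g₃)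
          + g₃ * g₄ * g₅ * (1 - g₁) * (1 - g₂)) := by
  have hK : 0 < K := by linarith
  set c : ℝ := lo / K with hc
  have hcK : c * K = lo := by rw [hc]; field_simp
  have hc4 : 1 / 4 ≤ c := by rw [hc, le_div_iff₀ hK]; linarith
  have hc2 : c ≤ 1 / 2 := by rw [hc, div_le_iff₀ hK]; linarith
  have h1 : c ≤ g₁ := by rw [hc, div_le_iff₀ hK]; linarith
  have h2 : c ≤ g₂ := by rw [hc, div_le_iff₀ hK]; linarith
  have h3 : c ≤ g₃ := by rw [hc, div_le_iff₀ hK]; linarith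
  have h4 : c ≤ g₄ := by rw [hc, div_le_iff₀ hK]; linarith
  have h5 : c ≤ g₅ := by rw [hc, div_le_iff₀ hK]; linarith
  have hg1 : 0 ≤ g₁ := le_trans (by rw [hc]; positivity) h1
  have hg2 : 0 ≤ g₂ := le_trans (by rw [hc]; positivity) h2
  have hg3 : 0 ≤ g₃ := le_trans (by rw [hc]; positivity) h3
  have hg4 : 0 ≤ g₄ := le_trans (by rw [hc]; positivity) h4
  have hg5 : 0 ≤ g₅ := le_trans (by rw [hc]; positivity) h5
  obtain ⟨n0, n1, n2, n3, n4⟩ := quintHub_masses_nonneg g₁ g₂ g₃ g₄ g₅ hg1 hg2 hg3 hg4 hg5 h11 h21 h31 h41 h51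
  set U0 := ((1 - g₁) * (1 - g₂) * (1 - g₃) * (1 - g₄) * (1 - g₅)) with hU0
  set U1 := (g₁ * (1 - g₂) * (1 - g₃) * (1 - g₄) * (1 - g₅) + g₂ * (1 - g₁) * (1 - g₃) * (1 - g₄) * (1 - g₅)
          + g₃ * (1 - g₁) * (1 - g₂) * (1 - g₄) * (1 - g₅) + g₄ * (1 - g₁) * (1 - g₂) * (1 - g₃) * (1 - g₅)
          + g₅ * (1 - g₁) * (1 - g₂) * (1 - g₃) * (1 - g₄)) with hU1
  set U2 := (g₁ * g₂ * (1 - g₃) * (1 - g₄) * (1 - g₅) + g₁ * g₃ * (1 - g₂) * (1 - g₄) * (1 - g₅) + g₁ * g₄ * (1 - g₂) * (1 - g₃) * (1 - g₅)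
          + g₁ * g₅ * (1 - g₂) * (1 - g₃) * (1 - g₄) + g₂ * g₃ * (1 - g₁) * (1 - g₄) * (1 - g₅) + g₂ * g₄ * (1 - g₁) * (1 - g₃) * (1 - g₅)
          + g₂ * g₅ * (1 - g₁) * (1 - g₃) * (1 - g₄) + g₃ * g₄ * (1 - g₁) * (1 - g₂) * (1 - g₅) + g₃ * g₅ * (1 - g₁) * (1 - g₂) * (1 - g₄)
          + g₄ * g₅ * (1 - g₁) * (1 - g₂) * (1 - g₃)) with hU2
  set U3 := (g₁ * g₂ * g₃ * (1 - g₄) * (1 - g₅) + g₁ * g₂ * g₄ * (1 - g₃) * (1 - g₅) + g₁ * g₂ * g₅ * (1 - g₃) * (1 - g₄)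
          + g₁ * g₃ * g₄ * (1 - g₂) * (1 - g₅) + g₁ * g₃ * g₅ * (1 - g₂) * (1 - g₄) + g₁ * g₄ * g₅ * (1 - g₂) * (1 - g₃)
          + g₂ * g₃ * g₄ * (1 - g₁) * (1 - g₅) + g₂ * g₃ * g₅ * (1 - g₁) * (1 - g₄) + g₂ * g₄ * g₅ * (1 - g₁) * (1 - g₃)
          + g₃ * g₄ * g₅ * (1 - g₁) * (1 - g₂)) with hU3
  set U4 := (g₁ * g₂ * g₃ * g₄ * (1 - g₅) + g₁ * g₂ * g₃ * g₅ * (1 - g₄) + g₁ * g₂ * g₄ * g₅ * (1 - g₃) + g₁ * g₃ * g₄ * g₅ * (1 - g₂)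
          + g₂ * g₃ * g₄ * g₅ * (1 - g₁)) with hU4
  clear_value c U0 U1 U2 U3 U4
  have hS1 : 5 * c + 1 ≤ g₁ + g₂ + g₃ + g₄ + g₅ := by
    have : (5 * c + 1) * K ≤ (g₁ + g₂ + g₃ + g₄ + g₅) * K := by linarith [hcK]
    exact le_of_mul_le_mul_right this hK
  by_cases hS : g₁ + g₂ + g₃ + g₄ + g₅ ≤ 5 * c + 2
  · have hC := quintHub_coreC1 g₁ g₂ g₃ g₄ g₅ c hc4 hc2 h1 h2 h3 h4 h5 h11 h21 h31 h41 h51 hS1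
    rw [← hU0, ← hU3] at hC
    have hDK : D + 10 * lo ≤ K * (g₁ + g₂ + g₃ + g₄ + g₅ + 5 * c) := by linarith [hcK]
    have h6 := mul_le_mul_of_nonneg_right hDK (add_nonneg n0 n3)
    have h7 := mul_le_mul_of_nonneg_left hC hK.le
    have e : 5 * (lo + K) * U3 = K * ((g₁ + g₂ + g₃ + g₄ + g₅ + 5 * c) * U3) + K * ((5 - (g₁ + g₂ + g₃ + g₄ + g₅)) * U3) := by
      rw [← hcK]; ring
    rw [e]; linarith [h6, h7]
  · push Not at hS
    have hC := quintHub_coreC2 g₁ g₂ g₃ g₄ g₅ c hc4 hc2 h1 h2 h3 h4 h5 h11 h21 h31 h41 h51 hS.le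
    rw [← hU0, ← hU3] at hC
    have hDK : D + 10 * lo ≤ K * (10 * c + 2) := by linarith [hcK]
    have h6 := mul_le_mul_of_nonneg_right hDK (add_nonneg n0 n3)
    have h7 := mul_le_mul_of_nonneg_left hC hK.le
    have e : 5 * (lo + K) * U3 = K * (5 * (1 + c) * U3) := by rw [← hcK]; ring
    rw [e]; linarith [h6, h7]

set_option maxHeartbeats 800000 in
/-- **credit capacity of `5lo → 5lo+3K`**: `D·u₀ ≤ (3K − D)·u₃` for `K ≤ D ≤ 2K`, `D ≤ K·Λ − 5lo` — DERIVED from the floor cores: C1 gives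
`u₃/u₀ ≥ (S+10c)/(5−5c−S) ≥ S/(3−S)` (`S ≤ 2 ≤ 30c/(2+5c)`), C2 gives `u₃ ≥ (10c+2)/(3−5c)·u₀ ≥ 2u₀` (`c ≥ 1/5`). [this work] -/
theorem quintHub_capDK (lo K g₁ g₂ g₃ g₄ g₅ D : ℝ) (hlo : 0 < lo) (hK2 : 2 * lo ≤ K) (hK8 : K ≤ 4 * lo)
    (hg₁ : lo ≤ K * g₁) (hg₂ : lo ≤ K * g₂) (hg₃ : lo ≤ K * g₃) (hg₄ : lo ≤ K * g₄) (hg₅ : lo ≤ K * g₅)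
    (h11 : g₁ ≤ 1) (h21 : g₂ ≤ 1) (h31 : g₃ ≤ 1) (h41 : g₄ ≤ 1) (h51 : g₅ ≤ 1)
    (hD1 : K ≤ D) (hD2 : D ≤ 2 * K) (hDS : D ≤ K * (g₁ + g₂ + g₃ + g₄ + g₅) - 5 * lo) :
    D * ((1 - g₁) * (1 - g₂) * (1 - g₃) * (1 - g₄) * (1 - g₅))
      ≤ (3 * K - D) * (g₁ * g₂ * g₃ * (1 - g₄) * (1 - g₅) + g₁ * g₂ * g₄ * (1 - g₃) * (1 - g₅) + g₁ * g₂ * g₅ * (1 - g₃) * (1 - g₄)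
          + g₁ * g₃ * g₄ * (1 - g₂) * (1 - g₅) + g₁ * g₃ * g₅ * (1 - g₂) * (1 - g₄) + g₁ * g₄ * g₅ * (1 - g₂) * (1 - g₃)
          + g₂ * g₃ * g₄ * (1 - g₁) * (1 - g₅) + g₂ * g₃ * g₅ * (1 - g₁) * (1 - g₄) + g₂ * g₄ * g₅ * (1 - g₁) * (1 - g₃)
          + g₃ * g₄ * g₅ * (1 - g₁) * (1 - g₂)) := by
  have hK : 0 < K := by linarith
  set c : ℝ := lo / K with hc
  have hcK : c * K = lo := by rw [hc]; field_simp
  have hc4 : 1 / 4 ≤ c := by rw [hc, le_div_iff₀ hK]; linarith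
  have hc2 : c ≤ 1 / 2 := by rw [hc, div_le_iff₀ hK]; linarith
  have h1 : c ≤ g₁ := by rw [hc, div_le_iff₀ hK]; linarith
  have h2 : c ≤ g₂ := by rw [hc, div_le_iff₀ hK]; linarith
  have h3 : c ≤ g₃ := by rw [hc, div_le_iff₀ hK]; linarith
  have h4 : c ≤ g₄ := by rw [hc, div_le_iff₀ hK]; linarith
  have h5 : c ≤ g₅ := by rw [hc, div_le_iff₀ hK]; linarith
  have hg1 : 0 ≤ g₁ := le_trans (by rw [hc]; positivity) h1
  have hg2 : 0 ≤ g₂ := le_trans (by rw [hc]; positivity) h2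
  have hg3 : 0 ≤ g₃ := le_trans (by rw [hc]; positivity) h3
  have hg4 : 0 ≤ g₄ := le_trans (by rw [hc]; positivity) h4
  have hg5 : 0 ≤ g₅ := le_trans (by rw [hc]; positivity) h5
  obtain ⟨n0, n1, n2, n3, n4⟩ := quintHub_masses_nonneg g₁ g₂ g₃ g₄ g₅ hg1 hg2 hg3 hg4 hg5 h11 h21 h31 h41 h51
  set U0 := ((1 - g₁) * (1 - g₂) * (1 - g₃) * (1 - g₄) * (1 - g₅)) with hU0
  set U1 := (g₁ * (1 - g₂) * (1 - g₃) * (1 - g₄) * (1 - g₅) + g₂ * (1 - g₁) * (1 - g₃) * (1 - g₄) * (1 - g₅)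
          + g₃ * (1 - g₁) * (1 - g₂) * (1 - g₄) * (1 - g₅) + g₄ * (1 - g₁) * (1 - g₂) * (1 - g₃) * (1 - g₅)
          + g₅ * (1 - g₁) * (1 - g₂) * (1 - g₃) * (1 - g₄)) with hU1
  set U2 := (g₁ * g₂ * (1 - g₃) * (1 - g₄) * (1 - g₅) + g₁ * g₃ * (1 - g₂) * (1 - g₄) * (1 - g₅) + g₁ * g₄ * (1 - g₂) * (1 - g₃) * (1 - g₅)
          + g₁ * g₅ * (1 - g₂) * (1 - g₃) * (1 - g₄) + g₂ * g₃ * (1 - g₁) * (1 - g₄) * (1 - g₅) + g₂ * g₄ * (1 - g₁) * (1 - g₃) * (1 - g₅)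
          + g₂ * g₅ * (1 - g₁) * (1 - g₃) * (1 - g₄) + g₃ * g₄ * (1 - g₁) * (1 - g₂) * (1 - g₅) + g₃ * g₅ * (1 - g₁) * (1 - g₂) * (1 - g₄)
          + g₄ * g₅ * (1 - g₁) * (1 - g₂) * (1 - g₃)) with hU2
  set U3 := (g₁ * g₂ * g₃ * (1 - g₄) * (1 - g₅) + g₁ * g₂ * g₄ * (1 - g₃) * (1 - g₅) + g₁ * g₂ * g₅ * (1 - g₃) * (1 - g₄)
          + g₁ * g₃ * g₄ * (1 - g₂) * (1 - g₅) + g₁ * g₃ * g₅ * (1 - g₂) * (1 - g₄) + g₁ * g₄ * g₅ * (1 - g₂) * (1 - g₃)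
          + g₂ * g₃ * g₄ * (1 - g₁) * (1 - g₅) + g₂ * g₃ * g₅ * (1 - g₁) * (1 - g₄) + g₂ * g₄ * g₅ * (1 - g₁) * (1 - g₃)
          + g₃ * g₄ * g₅ * (1 - g₁) * (1 - g₂)) with hU3
  set U4 := (g₁ * g₂ * g₃ * g₄ * (1 - g₅) + g₁ * g₂ * g₃ * g₅ * (1 - g₄) + g₁ * g₂ * g₄ * g₅ * (1 - g₃) + g₁ * g₃ * g₄ * g₅ * (1 - g₂)
          + g₂ * g₃ * g₄ * g₅ * (1 - g₁)) with hU4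
  clear_value c U0 U1 U2 U3 U4
  have hS1 : 5 * c + 1 ≤ g₁ + g₂ + g₃ + g₄ + g₅ := by
    have : (5 * c + 1) * K ≤ (g₁ + g₂ + g₃ + g₄ + g₅) * K := by linarith [hcK]
    exact le_of_mul_le_mul_right this hK
  set Sv : ℝ := g₁ + g₂ + g₃ + g₄ + g₅ - 5 * c with hSv
  have hdS : D ≤ K * Sv := by rw [hSv]; linarith [hcK]
  by_cases hS : g₁ + g₂ + g₃ + g₄ + g₅ ≤ 5 * c + 2
  · have hC := quintHub_coreC1 g₁ g₂ g₃ g₄ g₅ c hc4 hc2 h1 h2 h3 h4 h5 h11 h21 h31 h41 h51 hS1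
    rw [← hU0, ← hU3] at hC
    have eC : (Sv + 10 * c) * U0 ≤ (5 - 5 * c - Sv) * U3 := by
      have e1 : Sv + 10 * c = g₁ + g₂ + g₃ + g₄ + g₅ + 5 * c := by rw [hSv]; ring
      have e2 : 5 - 5 * c - Sv = 5 - (g₁ + g₂ + g₃ + g₄ + g₅) := by rw [hSv]; ring
      rw [e1, e2]; exact hC
    have hS2 : Sv ≤ 2 := by rw [hSv]; linarith
    have hS0 : 1 ≤ Sv := by rw [hSv]; linarith
    -- `S(5−5c−S) ≤ (3−S)(S+10c)` since `S(2+5c) ≤ 30c`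
    have hpoly : Sv * (5 - 5 * c - Sv) ≤ (3 - Sv) * (Sv + 10 * c) := by
      have k : Sv * (2 + 5 * c) ≤ 2 * (2 + 5 * c) := mul_le_mul_of_nonneg_right hS2 (by linarith)
      linarith
    have hA0 : 0 < Sv + 10 * c := by linarith
    -- `(S+10c)·(S·U0) ≤ S·(5−5c−S)·U3 ≤ (3−S)(S+10c)·U3`
    have k1' := mul_le_mul_of_nonneg_left eC (by linarith : (0:ℝ) ≤ Sv)
    have k1 : (Sv + 10 * c) * (Sv * U0) ≤ Sv * ((5 - 5 * c - Sv) * U3) := by linarith [k1']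
    have k2' := mul_le_mul_of_nonneg_right hpoly n3
    have k2 : Sv * ((5 - 5 * c - Sv) * U3) ≤ (3 - Sv) * (Sv + 10 * c) * U3 := by linarith [k2']
    have k3 : (Sv + 10 * c) * (Sv * U0) ≤ (Sv + 10 * c) * ((3 - Sv) * U3) := by linarith
    have k4 : Sv * U0 ≤ (3 - Sv) * U3 := le_of_mul_le_mul_left k3 hA0
    -- back to `D`: `D·U0 ≤ K·S·U0 ≤ K(3−S)U3 ≤ (3K−D)U3`
    have h6 := mul_le_mul_of_nonneg_right hdS n0
    have h7 := mul_le_mul_of_nonneg_left k4 hK.le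
    have h8 : (K * (3 - Sv)) * U3 ≤ (3 * K - D) * U3 := mul_le_mul_of_nonneg_right (by linarith) n3
    linarith [h6, h7, h8]
  · push Not at hS
    have hC := quintHub_coreC2 g₁ g₂ g₃ g₄ g₅ c hc4 hc2 h1 h2 h3 h4 h5 h11 h21 h31 h41 h51 hS.le
    rw [← hU0, ← hU3] at hC
    -- `(10c+2)U0 ≤ (3−5c)U3` and `10c+2 ≥ 2(3−5c)`... gives `2U0 ≤ U3`
    have k0 : (3 - 5 * c) * (2 * U0) ≤ (3 - 5 * c) * U3 := by linarith [hC, mul_nonneg (by linarith : (0:ℝ) ≤ 20 * c - 4) n0]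
    have k1 : 2 * U0 ≤ U3 := le_of_mul_le_mul_left k0 (by linarith)
    have h6 : D * U0 ≤ 2 * K * U0 := mul_le_mul_of_nonneg_right hD2 n0
    have h7' := mul_le_mul_of_nonneg_left k1 hK.le
    have h7 : 2 * K * U0 ≤ K * U3 := by linarith [h7']
    have h8 : K * U3 ≤ (3 * K - D) * U3 := mul_le_mul_of_nonneg_right (by linarith) n3
    linarith


end LawDec
end Quant
end Summit.CriticalPhenomena.PercolationContinuityZ3.Theorems
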